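import Summits.CriticalPhenomena.SAWScalingLimit.Theses.SAWTotalPositivity

/-!
# Radial chain for `TPToTraversalBound`, part I: the abstract multi-scale iteration

Crux `SAWTotalPositivity.TPToTraversalBound` (stmt-CriticalPhenomena-10687), line
`radial-portal-transfer`, stub `stub_chain`. Pure finite probability, no SAW: a finite weighted set
`X` (`w ≥ 0`), a tower of configuration maps `f l : X → A`, `l ≤ L`, each determined by the next
one, states `h l : X → ℕ` constant on the atoms of `f l`; (top) `w {h 0 ≥ m} ≤ C_T e^{-c₁ m}`,
(step) `w ({f l = f l x₀} ∩ {h (l+1) ≥ j}) ≤ C 2^{-λ₀ j} w {f l = f l x₀}` for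
`j ≥ θ h l x₀ + m₀`, `0 ≤ θ < 1`. The supermartingale `Y_l = 2^{μ h_l} ∏_{i ≤ l} 1{h_i ≥ k}`
gives `w {∀ l ≤ L, h l ≥ k} ≤ C_Y ζ(k)^L`, `ζ(k) = 2^{μ m₀} 2^{-μ(1-θ)k} + C 2^{(μ-λ₀)k}/(1 - 2^{μ-λ₀})
→ 0`, `C_Y = C_T/(1 - 2^μ e^{-c₁})` (`chain_iter_bound`; packaged as `stub_chain_iter`).
(Kemppainen–Smirnov, Ann. Probab. 45 (2017) §3, proof of Thm 3.4; Aizenman–Burchard 1999 §1.b.) -/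

noncomputable section

open Finset Real Filter Topology

namespace Summit.CriticalPhenomena.SAWScalingLimit.Theorems.TPToTraversalBound.Radial

variable {X A : Type*} [DecidableEq A]

/-! ## Constants of the chain -/

/-- `2^{μ - λ₀} < 1` for `μ < λ₀`. [folklore] -/
theorem two_rpow_sub_lt_one {μ lam0 : ℝ} (h : μ < lam0) : (2 : ℝ) ^ (μ - lam0) < 1 :=
  Real.rpow_lt_one_of_one_lt_of_neg (by norm_num) (by linarith)

/-- `2^μ e^{-c₁} < 1` when `μ log 2 < c₁`. [folklore] -/
theorem two_rpow_mul_exp_lt_one {μ c₁ : ℝ} (h : μ * Real.log 2 < c₁) :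
    (2 : ℝ) ^ μ * Real.exp (-c₁) < 1 := by
  rw [Real.rpow_def_of_pos (by norm_num : (0 : ℝ) < 2), ← Real.exp_add, Real.exp_lt_one_iff]
  linarith [mul_comm μ (Real.log 2)]

/-- The contraction ratio `ζ(k)` is nonnegative (`C ≥ 0`, `μ < λ₀`). [folklore] -/
theorem zeta_nonneg {μ θ lam0 C : ℝ} {m₀ : ℕ} (hμ : μ < lam0) (hC : 0 ≤ C) (k : ℕ) :
    0 ≤ (2 : ℝ) ^ (μ * m₀) * (2 : ℝ) ^ (-(μ * (1 - θ) * k)) +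
        C / (1 - (2 : ℝ) ^ (μ - lam0)) * (2 : ℝ) ^ ((μ - lam0) * k) := by
  have h1 := two_rpow_sub_lt_one hμ
  have : 0 ≤ C / (1 - (2 : ℝ) ^ (μ - lam0)) := div_nonneg hC (by linarith)
  positivity

/-- **`ζ(k) → 0`**: both terms are geometric in `k` with ratio `< 1`. [folklore] -/
theorem tendsto_zeta {μ θ lam0 C : ℝ} {m₀ : ℕ} (hμ0 : 0 < μ) (hμ : μ < lam0) (hθ : θ < 1) :
    Tendsto (fun k : ℕ => (2 : ℝ) ^ (μ * m₀) * (2 : ℝ) ^ (-(μ * (1 - θ) * k)) +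
        C / (1 - (2 : ℝ) ^ (μ - lam0)) * (2 : ℝ) ^ ((μ - lam0) * k)) atTop (𝓝 0) := by
  have two : (0 : ℝ) ≤ 2 := by norm_num
  have h1 : ∀ k : ℕ, (2 : ℝ) ^ (-(μ * (1 - θ) * k)) = ((2 : ℝ) ^ (-(μ * (1 - θ)))) ^ k :=
    fun k => by rw [← Real.rpow_natCast, ← Real.rpow_mul two]; ring_nf
  have h2 : ∀ k : ℕ, (2 : ℝ) ^ ((μ - lam0) * k) = ((2 : ℝ) ^ (μ - lam0)) ^ k :=
    fun k => by rw [← Real.rpow_natCast, ← Real.rpow_mul two]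
  have r1 : (2 : ℝ) ^ (-(μ * (1 - θ))) < 1 :=
    Real.rpow_lt_one_of_one_lt_of_neg (by norm_num) (by nlinarith)
  have r2 := two_rpow_sub_lt_one hμ
  have t1 := tendsto_pow_atTop_nhds_zero_of_lt_one (Real.rpow_nonneg two _) r1
  have t2 := tendsto_pow_atTop_nhds_zero_of_lt_one (Real.rpow_nonneg two _) r2
  have := (t1.const_mul ((2 : ℝ) ^ (μ * m₀))).add (t2.const_mul (C / (1 - (2 : ℝ) ^ (μ - lam0))))
  simp only [mul_zero, add_zero] at this
  refine this.congr fun k => ?_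
  simp only [h1, h2]

/-! ## A weighted geometric tail bound -/

/-- **Weighted geometric tail.** If for every `j ≥ J` the `B^j`-weighted mass of `{g ≥ j}`
inside `S` is at most `D r^j` (`0 ≤ r < 1`), then `∑_{x ∈ S, g x ≥ J} B^{g x} w x ≤ D r^J/(1-r)`
(slice by the value of `g`, sum the geometric series). [folklore] -/
theorem tail_sum_le (S : Finset X) (g : X → ℕ) (w : X → ℝ) (hw : ∀ x, 0 ≤ w x) (B D r : ℝ)
    (hB : 0 ≤ B) (hD : 0 ≤ D) (hr0 : 0 ≤ r) (hr1 : r < 1) (J : ℕ)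
    (hyp : ∀ j : ℕ, J ≤ j → B ^ j * ∑ x ∈ S with j ≤ g x, w x ≤ D * r ^ j) :
    ∑ x ∈ S with J ≤ g x, B ^ g x * w x ≤ D * r ^ J / (1 - r) := by
  classical
  set T : Finset X := S.filter fun x => J ≤ g x with hT
  set Im : Finset ℕ := T.image g with hIm
  have hfib : ∑ x ∈ T, B ^ g x * w x = ∑ j ∈ Im, ∑ x ∈ T with g x = j, B ^ g x * w x :=
    (Finset.sum_fiberwise_of_maps_to (fun x hx => Finset.mem_image_of_mem g hx) _).symm
  rw [hfib]
  have hJj : ∀ j ∈ Im, J ≤ j := fun j hj => by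
    obtain ⟨x, hx, rfl⟩ := Finset.mem_image.1 hj
    exact (Finset.mem_filter.1 hx).2
  -- each slice is bounded by `D r^j`
  have hslice : ∀ j ∈ Im, ∑ x ∈ T with g x = j, B ^ g x * w x ≤ D * r ^ j := by
    intro j hj
    calc ∑ x ∈ T with g x = j, B ^ g x * w x
        = B ^ j * ∑ x ∈ T with g x = j, w x := by
          rw [Finset.mul_sum]
          refine Finset.sum_congr rfl fun x hx => ?_
          rw [(Finset.mem_filter.1 hx).2]
      _ ≤ B ^ j * ∑ x ∈ S with j ≤ g x, w x := by
          refine mul_le_mul_of_nonneg_left ?_ (pow_nonneg hB _)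
          refine Finset.sum_le_sum_of_subset_of_nonneg ?_ fun x _ _ => hw x
          intro x hx
          simp only [hT, Finset.mem_filter] at hx ⊢
          exact ⟨hx.1.1, hx.2 ▸ le_rfl⟩
      _ ≤ D * r ^ j := hyp j (hJj j hj)
  -- the slices lie in `[J, M]`
  set M : ℕ := Im.sup id with hM
  have hsub : Im ⊆ Finset.Ico J (M + 1) := fun j hj =>
    Finset.mem_Ico.2 ⟨hJj j hj, Nat.lt_succ_of_le (Finset.le_sup (f := id) hj)⟩
  calc ∑ j ∈ Im, ∑ x ∈ T with g x = j, B ^ g x * w x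
      ≤ ∑ j ∈ Im, D * r ^ j := Finset.sum_le_sum hslice
    _ ≤ ∑ j ∈ Finset.Ico J (M + 1), D * r ^ j :=
        Finset.sum_le_sum_of_subset_of_nonneg hsub fun j _ _ =>
          mul_nonneg hD (pow_nonneg hr0 _)
    _ = D * ∑ j ∈ Finset.Ico J (M + 1), r ^ j := by rw [Finset.mul_sum]
    _ ≤ D * (r ^ J / (1 - r)) :=
        mul_le_mul_of_nonneg_left (geom_sum_Ico_le_of_lt_one hr0 hr1) hD
    _ = D * r ^ J / (1 - r) := by ring

/-! ## One atom, one scale -/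

/-- **One step of the chain on one atom.** On an atom `S` of the scale-`l` configuration with
heaviness `m ≥ k`, if the next-scale heaviness `g` has the conditional tail
`w(S ∩ {g ≥ j}) ≤ C 2^{-λ₀ j} w(S)` for `j ≥ θ m + m₀`, then
`∑_{S ∩ {g ≥ k}} 2^{μ g} w ≤ ζ(k) 2^{μ m} w(S)`: below the forced level `θ m + m₀` the
potential is at most `2^{μ(θ m + m₀)} ≤ 2^{μ m₀} 2^{-μ(1-θ)k} 2^{μ m}`, above it the tail is
geometric. [cite: KemppainenSmirnov2017, §3 (proof of Thm 3.4)] -/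
theorem atom_step (S : Finset X) (g : X → ℕ) (w : X → ℝ) (hw : ∀ x, 0 ≤ w x)
    {μ θ lam0 C : ℝ} {m₀ m k : ℕ} (hμ0 : 0 < μ) (hμ : μ < lam0) (hθ0 : 0 ≤ θ) (hθ1 : θ < 1)
    (hC : 0 ≤ C) (hkm : k ≤ m)
    (hyp : ∀ j : ℕ, θ * m + m₀ ≤ (j : ℝ) →
      ∑ x ∈ S with j ≤ g x, w x ≤ C * (2 : ℝ) ^ (-(lam0 * j)) * ∑ x ∈ S, w x) :
    ∑ x ∈ S with k ≤ g x, ((2 : ℝ) ^ μ) ^ g x * w x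
      ≤ ((2 : ℝ) ^ (μ * m₀) * (2 : ℝ) ^ (-(μ * (1 - θ) * k)) +
          C / (1 - (2 : ℝ) ^ (μ - lam0)) * (2 : ℝ) ^ ((μ - lam0) * k)) *
        ((2 : ℝ) ^ μ) ^ m * ∑ x ∈ S, w x := by
  classical
  have two : (0 : ℝ) ≤ 2 := by norm_num
  set B : ℝ := (2 : ℝ) ^ μ with hB
  have hB1 : 1 ≤ B := Real.one_le_rpow (by norm_num) hμ0.le
  have hB0 : 0 ≤ B := zero_le_one.trans hB1
  set W : ℝ := ∑ x ∈ S, w x with hW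
  have hW0 : 0 ≤ W := Finset.sum_nonneg fun x _ => hw x
  have hBpow : ∀ n : ℕ, B ^ n = (2 : ℝ) ^ (μ * n) := fun n => by
    rw [hB, ← Real.rpow_natCast, ← Real.rpow_mul two]
  -- the forced level
  set J : ℕ := max k (⌈θ * m⌉₊ + m₀) with hJ
  have hJk : k ≤ J := le_max_left _ _
  have hJθ : θ * m + m₀ ≤ (J : ℝ) := by
    have h2 : ((⌈θ * m⌉₊ + m₀ : ℕ) : ℝ) ≤ (J : ℝ) := by exact_mod_cast le_max_right _ _
    push_cast at h2; linarith [Nat.le_ceil (θ * m)]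
  -- split at `J`
  have hsplit : ∑ x ∈ S with k ≤ g x, B ^ g x * w x =
      ∑ x ∈ (S.filter fun x => k ≤ g x) with g x < J, B ^ g x * w x +
        ∑ x ∈ S with J ≤ g x, B ^ g x * w x := by
    rw [← Finset.sum_filter_add_sum_filter_not (S.filter fun x => k ≤ g x) (fun x => g x < J)]
    congr 1
    refine Finset.sum_congr ?_ fun _ _ => rfl
    ext x
    simp only [Finset.mem_filter, not_lt]
    exact ⟨fun ⟨⟨hx, _⟩, h2⟩ => ⟨hx, h2⟩, fun ⟨hx, h2⟩ => ⟨⟨hx, hJk.trans h2⟩, h2⟩⟩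
  -- low part: each term at most `2^{μ(θ m + m₀)}`
  have hlow : ∑ x ∈ (S.filter fun x => k ≤ g x) with g x < J, B ^ g x * w x ≤
      (2 : ℝ) ^ (μ * m₀) * (2 : ℝ) ^ (-(μ * (1 - θ) * k)) * B ^ m * W := by
    have hterm : ∀ x ∈ (S.filter fun x => k ≤ g x).filter (fun x => g x < J),
        B ^ g x * w x ≤ (2 : ℝ) ^ (μ * (θ * m + m₀)) * w x := by
      intro x hx
      obtain ⟨⟨-, hkx⟩, hxJ⟩ := Finset.mem_filter.1 hx |>.imp_left Finset.mem_filter.1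
      refine mul_le_mul_of_nonneg_right ?_ (hw x)
      -- here `J > k`, so `J = ⌈θ m⌉₊ + m₀` and `g x ≤ J - 1 ≤ θ m + m₀`
      have hJeq : J = ⌈θ * m⌉₊ + m₀ :=
        max_eq_right (not_lt.1 fun hlt => by have := max_eq_left hlt.le; omega)
      have hgx : (g x : ℝ) ≤ θ * m + m₀ := by
        have h2 : ((g x + 1 : ℕ) : ℝ) ≤ ((⌈θ * m⌉₊ + m₀ : ℕ) : ℝ) := by exact_mod_cast (by omega)
        have h3 : (⌈θ * m⌉₊ : ℝ) < θ * m + 1 := Nat.ceil_lt_add_one (by positivity)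
        push_cast at h2
        linarith
      rw [hBpow]
      exact Real.rpow_le_rpow_of_exponent_le (by norm_num)
        (mul_le_mul_of_nonneg_left hgx hμ0.le)
    have hexp : (2 : ℝ) ^ (μ * (θ * m + m₀)) ≤
        (2 : ℝ) ^ (μ * m₀) * (2 : ℝ) ^ (-(μ * (1 - θ) * k)) * B ^ m := by
      rw [hBpow, ← Real.rpow_add (by norm_num), ← Real.rpow_add (by norm_num)]
      refine Real.rpow_le_rpow_of_exponent_le (by norm_num) ?_
      have h1 : μ * (1 - θ) * k ≤ μ * (1 - θ) * m :=
        mul_le_mul_of_nonneg_left (by exact_mod_cast hkm) (mul_nonneg hμ0.le (by linarith))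
      nlinarith
    calc ∑ x ∈ (S.filter fun x => k ≤ g x) with g x < J, B ^ g x * w x
        ≤ ∑ x ∈ (S.filter fun x => k ≤ g x) with g x < J, (2 : ℝ) ^ (μ * (θ * m + m₀)) * w x :=
          Finset.sum_le_sum hterm
      _ = (2 : ℝ) ^ (μ * (θ * m + m₀)) * ∑ x ∈ (S.filter fun x => k ≤ g x) with g x < J, w x := by
          rw [Finset.mul_sum]
      _ ≤ (2 : ℝ) ^ (μ * (θ * m + m₀)) * W :=
          mul_le_mul_of_nonneg_left (Finset.sum_le_sum_of_subset_of_nonneg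
            (fun x hx => (Finset.mem_filter.1 (Finset.mem_filter.1 hx).1).1) fun x _ _ => hw x)
            (Real.rpow_nonneg two _)
      _ ≤ (2 : ℝ) ^ (μ * m₀) * (2 : ℝ) ^ (-(μ * (1 - θ) * k)) * B ^ m * W :=
          mul_le_mul_of_nonneg_right hexp hW0
  -- high part: geometric tail
  set r : ℝ := (2 : ℝ) ^ (μ - lam0) with hr
  have hr0 : 0 ≤ r := Real.rpow_nonneg two _
  have hr1 : r < 1 := two_rpow_sub_lt_one hμ
  have hrpow : ∀ n : ℕ, r ^ n = (2 : ℝ) ^ ((μ - lam0) * n) := fun n => by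
    rw [hr, ← Real.rpow_natCast, ← Real.rpow_mul two]
  have hhigh : ∑ x ∈ S with J ≤ g x, B ^ g x * w x ≤
      C / (1 - r) * (2 : ℝ) ^ ((μ - lam0) * k) * B ^ m * W := by
    have htail := tail_sum_le S g w hw B (C * W) r hB0 (mul_nonneg hC hW0) hr0 hr1 J
      (fun j hj => by
        have hj' : θ * m + m₀ ≤ (j : ℝ) := hJθ.trans (by exact_mod_cast hj)
        calc B ^ j * ∑ x ∈ S with j ≤ g x, w x
            ≤ B ^ j * (C * (2 : ℝ) ^ (-(lam0 * j)) * W) :=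
              mul_le_mul_of_nonneg_left (hyp j hj') (pow_nonneg hB0 _)
          _ = C * W * r ^ j := by
              rw [hBpow, hrpow, show ((μ - lam0) * j : ℝ) = μ * j + -(lam0 * j) by ring,
                Real.rpow_add (by norm_num)]
              ring)
    have hrJ : r ^ J ≤ r ^ k := pow_le_pow_of_le_one hr0 hr1.le hJk
    have h1r : 0 < 1 - r := by linarith
    calc ∑ x ∈ S with J ≤ g x, B ^ g x * w x ≤ C * W * r ^ J / (1 - r) := htail
      _ ≤ C * W * r ^ k / (1 - r) := by
          refine div_le_div_of_nonneg_right ?_ h1r.le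
          exact mul_le_mul_of_nonneg_left hrJ (mul_nonneg hC hW0)
      _ = C / (1 - r) * (2 : ℝ) ^ ((μ - lam0) * k) * 1 * W := by rw [hrpow]; ring
      _ ≤ C / (1 - r) * (2 : ℝ) ^ ((μ - lam0) * k) * B ^ m * W := by
          refine mul_le_mul_of_nonneg_right ?_ hW0
          refine mul_le_mul_of_nonneg_left (one_le_pow₀ hB1) ?_
          exact mul_nonneg (div_nonneg hC h1r.le) (Real.rpow_nonneg two _)
  rw [hsplit]
  calc _ ≤ (2 : ℝ) ^ (μ * m₀) * (2 : ℝ) ^ (-(μ * (1 - θ) * k)) * B ^ m * W +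
        C / (1 - r) * (2 : ℝ) ^ ((μ - lam0) * k) * B ^ m * W := add_le_add hlow hhigh
    _ = _ := by rw [hr]; ring

/-! ## The iteration -/

section Iteration

variable [Fintype X]

omit [DecidableEq A] [Fintype X] in
/-- Saturation: the scale-`l` configuration determines every coarser one. [folklore] -/
theorem f_eq_of_le {f : ℕ → X → A} {L : ℕ}
    (hrefine : ∀ l, l < L → ∀ x y, f (l + 1) x = f (l + 1) y → f l x = f l y)
    {i l : ℕ} (hil : i ≤ l) (hl : l ≤ L) {x y : X} (h : f l x = f l y) : f i x = f i y := by
  induction l generalizing i with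
  | zero => obtain rfl : i = 0 := Nat.le_zero.1 hil; exact h
  | succ l ih =>
    rcases Nat.lt_or_eq_of_le hil with hlt | rfl
    · exact ih (Nat.lt_succ_iff.1 hlt) (Nat.le_of_succ_le hl) (hrefine l hl x y h)
    · exact h

/-- **The radial chain iteration** (abstract supermartingale over scales). Under (top), (step),
refinement of the configuration maps and measurability of the heaviness w.r.t. its own scale,
`w {∀ l ≤ L, h l ≥ k} ≤ C_Y ζ(k)^L` with `ζ(k)`, `C_Y` depending only on the constants:
`Φ_l := ∑_{∀ i ≤ l, h i ≥ k} 2^{μ h_l} w` satisfies `Φ_{l+1} ≤ ζ Φ_l` atom by atom (`atom_step`;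
`∏_{i ≤ l} 1{h_i ≥ k}` is constant on the atoms of `f l`) and `Φ_0 ≤ C_Y` (`tail_sum_le`).
[cite: KemppainenSmirnov2017, §3 (proof of Thm 3.4)] -/
theorem chain_iter_bound (w : X → ℝ) (hw : ∀ x, 0 ≤ w x) (f : ℕ → X → A) (h : ℕ → X → ℕ)
    (L : ℕ) {θ lam0 C CT c₁ μ : ℝ} {m₀ : ℕ} (k : ℕ)
    (hθ0 : 0 ≤ θ) (hθ1 : θ < 1) (hμ0 : 0 < μ) (hμ1 : μ < lam0) (hμc : μ * Real.log 2 < c₁)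
    (hC : 0 ≤ C) (hCT : 0 ≤ CT)
    (hrefine : ∀ l, l < L → ∀ x y, f (l + 1) x = f (l + 1) y → f l x = f l y)
    (hmeas : ∀ l, l ≤ L → ∀ x y, f l x = f l y → h l x = h l y)
    (htop : ∀ m : ℕ, ∑ x with m ≤ h 0 x, w x ≤ CT * Real.exp (-(c₁ * m)))
    (hstep : ∀ l, l < L → ∀ (x₀ : X) (j : ℕ), θ * h l x₀ + m₀ ≤ (j : ℝ) →
      ∑ x with (f l x = f l x₀ ∧ j ≤ h (l + 1) x), w x
        ≤ C * (2 : ℝ) ^ (-(lam0 * j)) * ∑ x with f l x = f l x₀, w x) :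
    ∑ x with (∀ l ≤ L, k ≤ h l x), w x ≤ CT / (1 - (2 : ℝ) ^ μ * Real.exp (-c₁)) *
      ((2 : ℝ) ^ (μ * m₀) * (2 : ℝ) ^ (-(μ * (1 - θ) * k)) +
        C / (1 - (2 : ℝ) ^ (μ - lam0)) * (2 : ℝ) ^ ((μ - lam0) * k)) ^ L := by
  classical
  set B : ℝ := (2 : ℝ) ^ μ with hB
  have hB1 : 1 ≤ B := Real.one_le_rpow (by norm_num) hμ0.le
  have hB0 : 0 ≤ B := zero_le_one.trans hB1
  set ζ : ℝ := (2 : ℝ) ^ (μ * m₀) * (2 : ℝ) ^ (-(μ * (1 - θ) * k)) +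
    C / (1 - (2 : ℝ) ^ (μ - lam0)) * (2 : ℝ) ^ ((μ - lam0) * k) with hζ
  have hζ0 : 0 ≤ ζ := zeta_nonneg hμ1 hC k
  set CY : ℝ := CT / (1 - (2 : ℝ) ^ μ * Real.exp (-c₁)) with hCY
  -- the good sets and the potential
  set E : ℕ → Finset X := fun l => Finset.univ.filter fun x => ∀ i ≤ l, k ≤ h i x with hE
  set Φ : ℕ → ℝ := fun l => ∑ x ∈ E l, B ^ h l x * w x with hΦ
  -- the good set `E l` is a union of atoms of `f l`
  have hEsat : ∀ l, l ≤ L → ∀ x y, f l x = f l y → (x ∈ E l ↔ y ∈ E l) := by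
    intro l hl x y hxy
    simp only [hE, Finset.mem_filter, Finset.mem_univ, true_and]
    refine forall_congr' fun i => forall_congr' fun hi => ?_
    rw [hmeas i (hi.trans hl) x y (f_eq_of_le hrefine hi hl hxy)]
  -- (1) initial potential
  have hΦ0 : Φ 0 ≤ CY := by
    set r : ℝ := B * Real.exp (-c₁) with hr
    have hr0 : 0 ≤ r := mul_nonneg hB0 (Real.exp_pos _).le
    have hr1 : r < 1 := two_rpow_mul_exp_lt_one hμc
    have hE0 : E 0 = Finset.univ.filter fun x => k ≤ h 0 x := by ext x; simp [hE]
    have htail := tail_sum_le (Finset.univ : Finset X) (h 0) w hw B CT r hB0 hCT hr0 hr1 k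
      (fun j _ => by
        calc B ^ j * ∑ x with j ≤ h 0 x, w x ≤ B ^ j * (CT * Real.exp (-(c₁ * j))) :=
              mul_le_mul_of_nonneg_left (htop j) (pow_nonneg hB0 _)
          _ = CT * r ^ j := by rw [hr, mul_pow, ← Real.exp_nat_mul]; ring_nf)
    have h1r : 0 < 1 - r := by linarith
    calc Φ 0 = ∑ x with k ≤ h 0 x, B ^ h 0 x * w x := by simp only [hΦ, hE0]
      _ ≤ CT * r ^ k / (1 - r) := htail
      _ ≤ CT * 1 / (1 - r) := by
          refine div_le_div_of_nonneg_right ?_ h1r.le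
          exact mul_le_mul_of_nonneg_left (pow_le_one₀ hr0 hr1.le) hCT
      _ = CY := by rw [hCY, hr, hB, mul_one]
  -- (2) one step
  have hstepΦ : ∀ l, l < L → Φ (l + 1) ≤ ζ * Φ l := by
    intro l hl
    set T : Finset A := (E l).image (f l) with hT
    -- fibre over the atoms of `f l`
    have hL : Φ (l + 1) = ∑ a ∈ T, ∑ x ∈ E (l + 1) with f l x = a, B ^ h (l + 1) x * w x := by
      refine (Finset.sum_fiberwise_of_maps_to (fun x hx => ?_) _).symm
      refine Finset.mem_image.2 ⟨x, ?_, rfl⟩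
      simp only [hE, Finset.mem_filter, Finset.mem_univ, true_and] at hx ⊢
      exact fun i hi => hx i (Nat.le_succ_of_le hi)
    have hR : Φ l = ∑ a ∈ T, ∑ x ∈ E l with f l x = a, B ^ h l x * w x :=
      (Finset.sum_fiberwise_of_maps_to (fun x hx => Finset.mem_image_of_mem _ hx) _).symm
    rw [hL, hR, Finset.mul_sum]
    refine Finset.sum_le_sum fun a ha => ?_
    obtain ⟨x₀, hx₀, rfl⟩ := Finset.mem_image.1 ha
    -- the atom of `x₀`
    set S : Finset X := Finset.univ.filter fun x => f l x = f l x₀ with hS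
    have hSl : (E l).filter (fun x => f l x = f l x₀) = S := by
      ext x
      simp only [hS, Finset.mem_filter, Finset.mem_univ, true_and]
      exact ⟨fun hx => hx.2, fun hx => ⟨(hEsat l hl.le x x₀ hx).2 hx₀, hx⟩⟩
    have hSl1 : (E (l + 1)).filter (fun x => f l x = f l x₀) =
        S.filter fun x => k ≤ h (l + 1) x := by
      ext x
      simp only [hS, hE, Finset.mem_filter, Finset.mem_univ, true_and]
      constructor
      · rintro ⟨hx, hfx⟩
        exact ⟨hfx, hx (l + 1) le_rfl⟩
      · rintro ⟨hfx, hkx⟩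
        refine ⟨fun i hi => ?_, hfx⟩
        rcases Nat.lt_or_eq_of_le hi with hlt | rfl
        · have hxE := (hEsat l hl.le x x₀ hfx).2 hx₀
          simp only [hE, Finset.mem_filter, Finset.mem_univ, true_and] at hxE
          exact hxE i (Nat.lt_succ_iff.1 hlt)
        · exact hkx
    rw [hSl, hSl1]
    -- heaviness on the atom
    set m : ℕ := h l x₀ with hm
    have hkm : k ≤ m := by
      simp only [hE, Finset.mem_filter, Finset.mem_univ, true_and] at hx₀
      exact hx₀ l le_rfl
    have hatom := atom_step S (h (l + 1)) w hw (μ := μ) (m₀ := m₀) hμ0 hμ1 hθ0 hθ1 hC hkm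
      (fun j hj => by
        have := hstep l hl x₀ j hj
        simpa only [hS, Finset.filter_filter] using this)
    have hright : ∑ x ∈ S, B ^ h l x * w x = B ^ m * ∑ x ∈ S, w x := by
      rw [Finset.mul_sum]
      refine Finset.sum_congr rfl fun x hx => ?_
      simp only [hS, Finset.mem_filter, Finset.mem_univ, true_and] at hx
      rw [hmeas l hl.le x x₀ hx]
    rw [hright, ← mul_assoc]
    exact hatom
  -- (3) iterate
  have hiter : ∀ l, l ≤ L → Φ l ≤ CY * ζ ^ l := by
    intro l
    induction l with
    | zero => intro _; simpa using hΦ0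
    | succ l ih =>
      intro hl
      calc Φ (l + 1) ≤ ζ * Φ l := hstepΦ l hl
        _ ≤ ζ * (CY * ζ ^ l) := mul_le_mul_of_nonneg_left (ih (by omega)) hζ0
        _ = CY * ζ ^ (l + 1) := by ring
  -- (4) drop the potential
  calc ∑ x with (∀ l ≤ L, k ≤ h l x), w x ≤ Φ L := by
        refine Finset.sum_le_sum fun x _ => ?_
        exact le_mul_of_one_le_left (hw x) (one_le_pow₀ hB1)
    _ ≤ CY * ζ ^ L := hiter L le_rfl

/-- **The radial chain iteration, packaged** (registered sub-goal `stub_chain_iter` of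
`stub_chain`). For constants `0 ≤ θ < 1`, `λ₀ > 0`, `c₁ > 0`, `C, C_T ≥ 0`, `m₀` and every
target ratio `ε > 0` there are a threshold `k` and `C_Y ≥ 0` such that every finite weighted
tower as in `chain_iter_bound` satisfies `w {∀ l ≤ L, h l ≥ k} ≤ C_Y ε^L` (choose
`μ = min(λ₀, c₁)/2` and `k` with `ζ(k) ≤ ε`). [cite: KemppainenSmirnov2017, §3 (proof of Thm 3.4)] -/
theorem stub_chain_iter : ∀ {θ lam0 C CT c₁ ε : ℝ} {m₀ : ℕ}, 0 ≤ θ → θ < 1 → 0 < lam0 →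
    0 < c₁ → 0 ≤ C → 0 ≤ CT → 0 < ε → ∃ (k : ℕ) (CY : ℝ), 0 ≤ CY ∧
      ∀ {X A : Type} [Fintype X] [DecidableEq A] (w : X → ℝ), (∀ x, 0 ≤ w x) →
      ∀ (f : ℕ → X → A) (h : ℕ → X → ℕ) (L : ℕ),
      (∀ l, l < L → ∀ x y, f (l + 1) x = f (l + 1) y → f l x = f l y) →
      (∀ l, l ≤ L → ∀ x y, f l x = f l y → h l x = h l y) →
      (∀ m : ℕ, ∑ x with m ≤ h 0 x, w x ≤ CT * Real.exp (-(c₁ * m))) →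
      (∀ l, l < L → ∀ (x₀ : X) (j : ℕ), θ * h l x₀ + m₀ ≤ (j : ℝ) →
        ∑ x with (f l x = f l x₀ ∧ j ≤ h (l + 1) x), w x
          ≤ C * (2 : ℝ) ^ (-(lam0 * j)) * ∑ x with f l x = f l x₀, w x) →
      ∑ x with (∀ l ≤ L, k ≤ h l x), w x ≤ CY * ε ^ L := by
  intro θ lam0 C CT c₁ ε m₀ hθ0 hθ1 hlam0 hc₁ hC hCT hε
  set μ : ℝ := min (lam0 / 2) (c₁ / 2) with hμ
  have hμ0 : 0 < μ := lt_min (by linarith) (by linarith)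
  have hμ1 : μ < lam0 := (min_le_left _ _).trans_lt (by linarith)
  have hμc : μ * Real.log 2 < c₁ := by
    have h1 : μ ≤ c₁ / 2 := min_le_right _ _
    have h2 : Real.log 2 < 1 := Real.log_two_lt_d9.trans (by norm_num)
    nlinarith [Real.log_pos one_lt_two]
  obtain ⟨k, hk⟩ := ((tendsto_order.1
    (tendsto_zeta (C := C) (m₀ := m₀) hμ0 hμ1 hθ1)).2 ε hε).exists
  have hCY : 0 ≤ CT / (1 - (2 : ℝ) ^ μ * Real.exp (-c₁)) :=
    div_nonneg hCT (by linarith [two_rpow_mul_exp_lt_one hμc])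
  refine ⟨k, _, hCY, fun w hw f h L hrefine hmeas htop hstep => ?_⟩
  exact (chain_iter_bound w hw f h L k hθ0 hθ1 hμ0 hμ1 hμc hC hCT hrefine hmeas htop hstep).trans
    (mul_le_mul_of_nonneg_left (pow_le_pow_left₀ (zeta_nonneg hμ1 hC k) hk.le L) hCY)

end Iteration

end Summit.CriticalPhenomena.SAWScalingLimit.Theorems.TPToTraversalBound.Radial

end
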